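import Literature.NumberTheory.LFunctions.LandauGonekFormulaSharp
import Literature.Analysis.SpecialFunctions.DigammaReflection
import Literature.Analysis.Complex.VerticalSinSummation
import HarnessLib

/-!
# Landau's formula over the zeros of `ζ`, uniformly in `x`, with error LINEAR in `x`

Topic: `Literature/NumberTheory/LFunctions`. THEOREMS (everything proved; no new definitions, no
named facts). A second refinement of `LandauGonek.landau_gonek_formula` /
`LandauGonek.landau_gonek_formula_sharp` (crude uniform forms of Gonek 1993 Thm. 1, summed
symmetrically over `|Im ρ| ≤ T`):

* `landau_gonek_formula_linear` — there is an absolute `C` with, for all real `x > 1` and `T ≥ 2`,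
  `‖∑_{|Im ρ| ≤ T} m(ρ) x^ρ + (T/π) Λ(x)‖
     ≤ C (x (log²T + log(1 + 1/log x)) (1 + 1/log x) + x log²(3x) + log(3x)·min(T, x/⟨x⟩))`.

Compared with `landau_gonek_formula_sharp`, whose error carries `x²(1 + 1/log x)² log²T` and
`x² log(3x)`, every term is now at most LINEAR in `x` and the blow-up as `x → 1⁺` is a single factor
`1/log x` (Gonek's third error term is `log 2T · min(T, 1/log x)`). This is what bilinear sums of
Landau's formula over the ratios `x = k/j` of integers `j < k ≤ y` need when `y` is as large as
`T^{1−δ}` (the Montgomery–Odlyzko method; the consumer is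
`Literature/NumberTheory/LFunctions/MontgomeryOdlyzkoCriterionProofs.lean`). Still a corollary of
[Gonek1993, Thm. 1]; no Brun–Titchmarsh input is used (hence `x log²(3x)` for Gonek's
`x log 2x loglog 3x`).
-- TODO(general form): Gonek's one-sided sum `0 < γ ≤ T` with the error terms as printed.

Proof: the contour of the tree's proof (`LandauGonek.rightEdge_identity_cpow`: a good height
`T₁ ∈ [T, T+1]`, the residue theorem on `(−∞, b] × [−T₁, T₁]`, `≪ log T` zeros between `T` and
`T₁`), with two changes following Gonek: (1) the right edge is taken at `b = 1 + 1/log(3x)`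
(`rightLine_bound_linear`: `2T₁Λ(x) + O(x log²(3x) + log(3x) min(T₁, x/⟨x⟩))`, the prime powers
`n ∈ (x/2, 2x)` with `|x − n| ≥ 1` paying `≪ x log(3x)/|x − n|`, a harmonic sum); (2) on the horizontal
half-lines the far-left bound for `ζ'/ζ(σ ± iT₁)` is LOGARITHMIC in `σ`
(`norm_logDeriv_riemannZeta_le_of_re_le_neg_half_log`, Montgomery–Vaughan Lemma 12.4, via the
reflection formula `ψ(s/2) = ψ(1 − s/2) − π cot(πs/2)`), so that the half-lines cost
`≪ x^b (log²T + log(1 + 1/log x))/log x` (`horizontal_integral_bound_cpow_log`) instead of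
`x²(log²T/log x + 1/log²x)`.

## References

* S. M. Gonek, *An explicit formula of Landau and its applications to the theory of the
  zeta-function*, Contemp. Math. 143 (1993), 395–413, Thm. 1. [Gonek1993]
* E. Landau, *Über die Nullstellen der Zetafunktion*, Math. Ann. 71 (1911), 548–564. [Landau1911]
* H. L. Montgomery, R. C. Vaughan, *Multiplicative Number Theory I*, CUP 2007, §12.1, Lemma 12.4.
  [MontgomeryVaughan2007]
-/

noncomputable section

open Complex Filter Set MeasureTheory Topology intervalIntegral
open ArithmeticFunction hiding log id
open scoped Real Interval

namespace Literature.NumberTheory.LFunctions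

namespace LandauGonek

open PsiOneExplicit ExplicitPsi PerronPsi

/-! ### `ζ'/ζ` far left with logarithmic growth in `σ` -/

/-- For `a ≥ 1`, `b ≥ 0`: `log(a + b) ≤ log a + log(1 + b)` (`a + b ≤ a(1+b)`). [folklore] -/
private theorem log_add_le_log_add_log_one_add {a b : ℝ} (ha : 1 ≤ a) (hb : 0 ≤ b) :
    Real.log (a + b) ≤ Real.log a + Real.log (1 + b) := by
  rw [← Real.log_mul (by linarith) (by linarith)]
  exact Real.log_le_log (by linarith) (by nlinarith)

/-- **`ζ'/ζ` far left, logarithmic in `σ`**: for `σ ≤ −1/2` and `|t| ≥ 2`,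
`‖ζ'/ζ(σ + it)‖ ≤ C_r + 10 + (3/2) log|t| + (3/2) log(3 − σ)` (`C_r` the constant of
`ZetaZeroSum.exists_norm_logDeriv_riemannXi_le_of_re_ge`): `ζ'/ζ = ξ'/ξ − 1/s − 1/(s−1) − Γ_ℝ'/Γ_ℝ`,
`|ξ'/ξ(σ+it)| = |ξ'/ξ(1−σ+it)| ≪ log|1−s|`, and `Γ_ℝ'/Γ_ℝ(s) = −½log π + ½ψ(s/2)` with the
reflection `ψ(s/2) = ψ(1 − s/2) − π cot(πs/2)`, `|cot| ≤ 2` off the real axis, `|ψ(1−s/2)| ≪ log|s|`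
(Montgomery–Vaughan Lemma 12.4: `ζ'/ζ(s) ≪ log(|s|+1)` there). [cite: MontgomeryVaughan2007, Lemma 12.4] -/
theorem norm_logDeriv_riemannZeta_le_of_re_le_neg_half_log {Cr : ℝ}
    (hCr : ∀ s : ℂ, 3 / 2 ≤ s.re →
      ‖logDeriv riemannXi s‖ ≤ Cr + ‖s‖ ∧
        (1 ≤ |s.im| → ‖logDeriv riemannXi s‖ ≤ Cr + Real.log (1 + ‖s‖)))
    {σ t : ℝ} (hσ : σ ≤ -(1 / 2)) (ht : 2 ≤ |t|) :
    ‖deriv riemannZeta (σ + t * I) / riemannZeta (σ + t * I)‖ ≤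
      Cr + 10 + 3 / 2 * Real.log |t| + 3 / 2 * Real.log (3 - σ) := by
  set s : ℂ := σ + t * I with hs
  have hsre : s.re = σ := by simp [hs]
  have hsim : s.im = t := by simp [hs]
  have ht0 : t ≠ 0 := fun h ↦ by rw [h] at ht; norm_num at ht
  have htpos : 0 < |t| := by linarith
  have hpole : ∀ n : ℕ, s ≠ -(2 * (n : ℂ)) := fun n h ↦ ht0 (by simpa [hsim] using congrArg Complex.im h)
  have h1 : s ≠ 1 := fun h ↦ ht0 (by simpa [hsim] using congrArg Complex.im h)
  have hζ : riemannZeta s ≠ 0 := by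
    intro hz
    obtain ⟨n, hn⟩ := (riemannZeta_eq_zero_iff_of_re_nonpos (by rw [hsre]; linarith)).1 hz
    exact ht0 (by simpa [hsim] using congrArg Complex.im hn)
  rw [logDeriv_riemannZeta_eq_of_ne_gammaPole hpole h1 hζ]
  -- `ξ'/ξ` by reflection
  have hnorm1 : ‖((1 - σ : ℝ) : ℂ) + t * I‖ ≤ (1 - σ) + |t| := by
    calc ‖((1 - σ : ℝ) : ℂ) + t * I‖ ≤ |(((1 - σ : ℝ) : ℂ) + t * I).re| + |(((1 - σ : ℝ) : ℂ) + t * I).im| :=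
          Complex.norm_le_abs_re_add_abs_im _
      _ = (1 - σ) + |t| := by simp [abs_of_pos (by linarith : (0 : ℝ) < 1 - σ)]
  have hlogmono : Real.log (1 + ((1 - σ) + |t|)) = Real.log (2 - σ + |t|) := by ring_nf
  have hξ : ‖logDeriv riemannXi s‖ ≤ Cr + Real.log (2 - σ + |t|) := by
    rw [hs, norm_logDeriv_riemannXi_reflect]
    set s' : ℂ := ((1 - σ : ℝ) : ℂ) + t * I with hs'
    have hre' : 3 / 2 ≤ s'.re := by simp [hs']; linarith
    have him' : 1 ≤ |s'.im| := by simp [hs']; linarith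
    have h := (hCr s' hre').2 him'
    have hl : Real.log (1 + ‖s'‖) ≤ Real.log (2 - σ + |t|) := by
      rw [← hlogmono]
      exact Real.log_le_log (by positivity) (by linarith)
    linarith
  -- `1/s`, `1/(s-1)`
  have hns : (2 : ℝ) ≤ ‖s‖ := ht.trans (by rw [← hsim]; exact Complex.abs_im_le_norm s)
  have hns1 : (2 : ℝ) ≤ ‖s - 1‖ := ht.trans (by
    have := Complex.abs_im_le_norm (s - 1); simpa [hsim] using this)
  have h1s : ‖1 / s‖ ≤ 1 / 2 := by
    rw [norm_div, norm_one]; exact one_div_le_one_div_of_le two_pos hns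
  have h1s1 : ‖1 / (s - 1)‖ ≤ 1 / 2 := by
    rw [norm_div, norm_one]; exact one_div_le_one_div_of_le two_pos hns1
  -- `Γ_ℝ'/Γ_ℝ` by the reflection formula for `ψ`
  have hΓ : ‖logDeriv Gammaℝ s‖ ≤ 1 + (Real.log (2 - σ + |t|) + 8 + 2 * π) / 2 := by
    have hpole2 : ∀ m : ℕ, s / 2 ≠ -m := fun m h ↦ hpole m (by linear_combination 2 * h)
    rw [logDeriv_Gammaℝ hpole2, ← Complex.ofReal_log Real.pi_pos.le]
    -- reflection: `ψ(s/2) = ψ(1 - s/2) - π cos(π s/2)/sin(π s/2)`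
    have hnotint : ∀ n : ℤ, s / 2 ≠ n := by
      intro n h
      have := congrArg Complex.im h
      simp [hsim] at this
      exact ht0 this
    have hrefl := Literature.Analysis.SpecialFunctions.Complex.digamma_one_sub_sub_digamma hnotint
    have hψeq : digamma (s / 2) = digamma (1 - s / 2) -
        π * Complex.cos (π * (s / 2)) / Complex.sin (π * (s / 2)) := by
      rw [← hrefl]; ring
    -- `ψ(1 - s/2)` is logarithmic
    have hw_re : 0 < (1 - s / 2).re := by simp [hsre]; linarith
    have hw_im : 1 / 2 ≤ |(1 - s / 2).im| := by
      simp [hsim, abs_div, abs_neg]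
      linarith
    have hψ1 := Literature.Analysis.SpecialFunctions.Complex.norm_digamma_le_log hw_re hw_im
    have hwn : ‖1 - s / 2‖ ≤ (1 - σ) + |t| := by
      have hsn : ‖s‖ ≤ |σ| + |t| := by simpa [hs] using Complex.norm_le_abs_re_add_abs_im s
      have hσabs : |σ| = -σ := abs_of_neg (by linarith)
      calc ‖1 - s / 2‖ ≤ ‖(1 : ℂ)‖ + ‖s / 2‖ := norm_sub_le _ _
        _ = 1 + ‖s‖ / 2 := by rw [norm_one, norm_div, Complex.norm_two]
        _ ≤ 1 + (|σ| + |t|) / 2 := by linarith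
        _ ≤ (1 - σ) + |t| := by rw [hσabs]; linarith [abs_nonneg t]
    have hl : Real.log (1 + ‖1 - s / 2‖) ≤ Real.log (2 - σ + |t|) := by
      rw [← hlogmono]
      exact Real.log_le_log (by positivity) (by linarith)
    -- the cotangent
    have hcot : ‖π * Complex.cos (π * (s / 2)) / Complex.sin (π * (s / 2))‖ ≤ 2 * π := by
      have him : 1 ≤ |(π * (s / 2) : ℂ).im| := by
        have e : (π * (s / 2) : ℂ).im = π * (t / 2) := by simp [hsim]
        rw [e, abs_mul, abs_of_pos Real.pi_pos]
        have : 1 ≤ |t / 2| := by rw [abs_div, abs_two]; linarith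
        nlinarith [Real.pi_gt_three, abs_nonneg (t / 2)]
      have h2 := Literature.Analysis.Complex.norm_cos_div_sin_le_two (π * (s / 2)) him
      rw [mul_div_assoc, norm_mul, Complex.norm_real, Real.norm_eq_abs, abs_of_pos Real.pi_pos]
      nlinarith [Real.pi_pos]
    have hπ : ‖(-(Real.log π : ℂ)) / 2‖ ≤ 1 := by
      rw [norm_div, norm_neg, Complex.norm_real, Real.norm_eq_abs, Complex.norm_two,
        abs_of_pos (Real.log_pos (by linarith [Real.pi_gt_three]))]
      linarith [log_pi_lt_two]
    have hψ2 : ‖digamma (s / 2)‖ ≤ Real.log (2 - σ + |t|) + 8 + 2 * π := by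
      rw [hψeq]
      calc ‖digamma (1 - s / 2) - π * Complex.cos (π * (s / 2)) / Complex.sin (π * (s / 2))‖
          ≤ ‖digamma (1 - s / 2)‖ + ‖π * Complex.cos (π * (s / 2)) / Complex.sin (π * (s / 2))‖ :=
            norm_sub_le _ _
        _ ≤ (Real.log (1 + ‖1 - s / 2‖) + 8) + 2 * π := add_le_add hψ1 hcot
        _ ≤ Real.log (2 - σ + |t|) + 8 + 2 * π := by linarith
    calc ‖-(Real.log π : ℂ) / 2 + digamma (s / 2) / 2‖
        ≤ ‖-(Real.log π : ℂ) / 2‖ + ‖digamma (s / 2) / 2‖ := norm_add_le _ _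
      _ ≤ 1 + (Real.log (2 - σ + |t|) + 8 + 2 * π) / 2 := by
          gcongr
          rw [norm_div, Complex.norm_two]
          linarith
  -- `log(2 − σ + |t|) ≤ log|t| + log(3 − σ)`
  have hsplit : Real.log (2 - σ + |t|) ≤ Real.log |t| + Real.log (3 - σ) := by
    have hle : 2 - σ + |t| ≤ |t| * (3 - σ) := by nlinarith
    calc Real.log (2 - σ + |t|) ≤ Real.log (|t| * (3 - σ)) :=
          Real.log_le_log (by linarith [abs_nonneg t]) hle
      _ = Real.log |t| + Real.log (3 - σ) := Real.log_mul (by linarith) (by linarith)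
  have hπ4 : π < 4 := by linarith [Real.pi_lt_d2]
  calc ‖logDeriv riemannXi s - 1 / s - 1 / (s - 1) - logDeriv Gammaℝ s‖
      ≤ ‖logDeriv riemannXi s‖ + ‖1 / s‖ + ‖1 / (s - 1)‖ + ‖logDeriv Gammaℝ s‖ := by
        refine (norm_sub_le _ _).trans ?_
        gcongr
        refine (norm_sub_le _ _).trans ?_
        gcongr
        exact norm_sub_le _ _
    _ ≤ (Cr + Real.log (2 - σ + |t|)) + 1 / 2 + 1 / 2 +
        (1 + (Real.log (2 - σ + |t|) + 8 + 2 * π) / 2) := by gcongr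
    _ ≤ Cr + 10 + 3 / 2 * Real.log |t| + 3 / 2 * Real.log (3 - σ) := by nlinarith

/-! ### The horizontal half-lines `(−∞, b] ± it`, logarithmic majorant -/

/-- `log(3 + u) ≤ log 3 + log(1 + 1/ℓ) + ℓ u` for `u ≥ 0`, `ℓ > 0`
(`3 + u ≤ 3(1+u) ≤ 3(1 + 1/ℓ)(1 + ℓu)` and `log(1 + ℓu) ≤ ℓu`). [folklore] -/
private theorem log_three_add_le {u ℓ : ℝ} (hu : 0 ≤ u) (hℓ : 0 < ℓ) :
    Real.log (3 + u) ≤ Real.log 3 + Real.log (1 + 1 / ℓ) + ℓ * u := by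
  have h1 : Real.log (3 + u) ≤ Real.log 3 + Real.log (1 + u) :=
    log_add_le_log_add_log_one_add (by norm_num) hu
  have h2 : 1 + u ≤ (1 + 1 / ℓ) * (1 + ℓ * u) := by
    have e : (1 + 1 / ℓ) * (1 + ℓ * u) = 1 + u + (ℓ * u + 1 / ℓ) := by field_simp; ring
    rw [e]
    have : 0 ≤ ℓ * u + 1 / ℓ := by positivity
    linarith
  have h3 : Real.log (1 + u) ≤ Real.log (1 + 1 / ℓ) + Real.log (1 + ℓ * u) := by
    rw [← Real.log_mul (by positivity) (by positivity)]
    exact Real.log_le_log (by linarith) h2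
  have h4 : Real.log (1 + ℓ * u) ≤ ℓ * u := by
    have := Real.log_le_sub_one_of_pos (show 0 < 1 + ℓ * u by positivity)
    linarith
  linarith

/-- **Pointwise bound on the half-lines, logarithmic majorant.** Let `x > 0`, `|t| ≥ 2`,
`0 < η ≤ 1` with all non-trivial zeros `η`-away from the ordinate `t`, and
`Λ₁ ≥ C_r + 10 + (3/2) log|t| + C_h log(|t|+4)/η + M₀` (`M₀ = ∑ Λ(n) n^{−3/2}`). Then for every `σ`,
`‖(−ζ'/ζ)(σ+it) x^{σ+it}‖ ≤ (Λ₁ + (3/2) log(3 + max(−σ,0))) x^σ`. [cite: MontgomeryVaughan2007, Thm. 12.5 (proof) with Lemma 12.4] -/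
theorem norm_integrand_horizontal_le_cpow_log {Cr Ch : ℝ}
    (hCr : ∀ s : ℂ, 3 / 2 ≤ s.re →
      ‖logDeriv riemannXi s‖ ≤ Cr + ‖s‖ ∧
        (1 ≤ |s.im| → ‖logDeriv riemannXi s‖ ≤ Cr + Real.log (1 + ‖s‖)))
    (hCh : ∀ (t η : ℝ), 2 ≤ |t| → 0 < η → η ≤ 1 →
      (∀ ρ ∈ RHWave0.riemannZetaNontrivialZeros, η ≤ |ρ.im - t|) →
      ∀ σ : ℝ, σ ∈ Icc (-(1 / 2) : ℝ) (3 / 2) →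
        ‖deriv riemannZeta (σ + t * I) / riemannZeta (σ + t * I)‖ ≤ Ch * Real.log (|t| + 4) / η)
    {x t η Λ₁ : ℝ} (hx : 0 < x) (ht : 2 ≤ |t|) (hη : 0 < η) (hη1 : η ≤ 1)
    (hZ : ∀ ρ ∈ RHWave0.riemannZetaNontrivialZeros, η ≤ |ρ.im - t|)
    (hΛ₁ : Cr + 10 + 3 / 2 * Real.log |t| + Ch * Real.log (|t| + 4) / η +
      ∑' n : ℕ, ‖LSeries.term (fun n ↦ (ArithmeticFunction.vonMangoldt n : ℂ)) (3 / 2 : ℂ) n‖ ≤ Λ₁)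
    (hCh0 : 0 ≤ Ch) (hCr0 : 0 ≤ Cr) (σ : ℝ) :
    ‖(fun s : ℂ ↦ (-deriv riemannZeta s / riemannZeta s) * (x : ℂ) ^ s) ((σ : ℂ) + t * I)‖ ≤
      (Λ₁ + 3 / 2 * Real.log (3 + max (-σ) 0)) * x ^ σ := by
  have ht0 : t ≠ 0 := fun h ↦ by rw [h, abs_zero] at ht; linarith
  have hM₀0 : 0 ≤ ∑' n : ℕ, ‖LSeries.term (fun n ↦ (ArithmeticFunction.vonMangoldt n : ℂ)) (3 / 2 : ℂ) n‖ :=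
    tsum_nonneg fun _ ↦ norm_nonneg _
  have hlogt : 0 ≤ Real.log |t| := Real.log_nonneg (by linarith)
  have hlog4 : 0 ≤ Real.log (|t| + 4) := Real.log_nonneg (by linarith)
  have hmax : 0 ≤ max (-σ) 0 := le_max_right _ _
  have hlog3 : 0 ≤ Real.log (3 + max (-σ) 0) := Real.log_nonneg (by linarith)
  have hCη : 0 ≤ Ch * Real.log (|t| + 4) / η := by positivity
  have hΛ₁0 : 0 ≤ Λ₁ := le_trans (by positivity) hΛ₁
  show ‖(-deriv riemannZeta ((σ : ℂ) + t * I) / riemannZeta ((σ : ℂ) + t * I)) *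
      (x : ℂ) ^ ((σ : ℂ) + t * I)‖ ≤ _
  rw [norm_mul, neg_div, norm_neg, Complex.norm_cpow_eq_rpow_re_of_pos hx]
  have hre : (((σ : ℂ) + t * I)).re = σ := by simp
  rw [hre]
  refine mul_le_mul_of_nonneg_right ?_ (Real.rpow_nonneg hx.le _)
  rcases le_or_gt σ (-(1 / 2)) with h1 | h1
  · have h := norm_logDeriv_riemannZeta_le_of_re_le_neg_half_log hCr h1 ht
    have hmaxeq : max (-σ) 0 = -σ := max_eq_left (by linarith)
    rw [hmaxeq, show (3 : ℝ) + -σ = 3 - σ by ring]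
    linarith
  rcases le_or_gt σ (3 / 2) with h2 | h2
  · have h := hCh t η ht hη hη1 hZ σ ⟨h1.le, h2⟩
    linarith
  · have hs : 3 / 2 ≤ ((σ : ℂ) + t * I).re := by simp; linarith
    have hs1 : 1 < ((σ : ℂ) + t * I).re := by simp; linarith
    have h := ZetaZeroSum.norm_LSeries_vonMangoldt_le_of_re_ge hs
    rw [ArithmeticFunction.LSeries_vonMangoldt_eq_deriv_riemannZeta_div hs1, neg_div, norm_neg] at h
    linarith

/-- **The horizontal half-lines, bound linear in `x^b`.** Under the hypotheses of
`norm_integrand_horizontal_le_cpow_log`, for `x > 1` and `b ≥ 0` the integrand is integrable on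
`(−∞, b] + it` and
`‖∫_{−∞}^{b} (−ζ'/ζ)(σ+it) x^{σ+it} dσ‖ ≤ x^b (Λ₁ + 6 + (3/2) log(1 + 1/log x))/log x`
(majorant `(Λ₁ + (3/2)(log 3 + log(1 + 1/log x))) x^σ + (3/e) x^{σ/2}`).
[cite: Gonek1993, Thm. 1 (proof)] -/
theorem horizontal_integral_bound_cpow_log {Cr Ch : ℝ}
    (hCr : ∀ s : ℂ, 3 / 2 ≤ s.re →
      ‖logDeriv riemannXi s‖ ≤ Cr + ‖s‖ ∧
        (1 ≤ |s.im| → ‖logDeriv riemannXi s‖ ≤ Cr + Real.log (1 + ‖s‖)))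
    (hCh : ∀ (t η : ℝ), 2 ≤ |t| → 0 < η → η ≤ 1 →
      (∀ ρ ∈ RHWave0.riemannZetaNontrivialZeros, η ≤ |ρ.im - t|) →
      ∀ σ : ℝ, σ ∈ Icc (-(1 / 2) : ℝ) (3 / 2) →
        ‖deriv riemannZeta (σ + t * I) / riemannZeta (σ + t * I)‖ ≤ Ch * Real.log (|t| + 4) / η)
    {x t η Λ₁ b : ℝ} (hx : 1 < x) (hb0 : 0 ≤ b) (ht : 2 ≤ |t|) (hη : 0 < η)
    (hη1 : η ≤ 1) (hZ : ∀ ρ ∈ RHWave0.riemannZetaNontrivialZeros, η ≤ |ρ.im - t|)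
    (hΛ₁ : Cr + 10 + 3 / 2 * Real.log |t| + Ch * Real.log (|t| + 4) / η +
      ∑' n : ℕ, ‖LSeries.term (fun n ↦ (ArithmeticFunction.vonMangoldt n : ℂ)) (3 / 2 : ℂ) n‖ ≤ Λ₁)
    (hCh0 : 0 ≤ Ch) (hCr0 : 0 ≤ Cr) :
    IntegrableOn (fun σ : ℝ ↦
      (fun s : ℂ ↦ (-deriv riemannZeta s / riemannZeta s) * (x : ℂ) ^ s) ((σ : ℂ) + t * I))
      (Iic b) ∧
    ‖∫ σ in Iic b,
        (fun s : ℂ ↦ (-deriv riemannZeta s / riemannZeta s) * (x : ℂ) ^ s) ((σ : ℂ) + t * I)‖ ≤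
      x ^ b * (Λ₁ + 6 + 3 / 2 * Real.log (1 + 1 / Real.log x)) / Real.log x := by
  have hx0 : 0 < x := by linarith
  have ht0 : t ≠ 0 := fun h ↦ by rw [h, abs_zero] at ht; linarith
  have hL0 : 0 < Real.log x := Real.log_pos hx
  set L : ℝ := Real.log x with hL
  have hM₀0 : 0 ≤ ∑' n : ℕ, ‖LSeries.term (fun n ↦ (ArithmeticFunction.vonMangoldt n : ℂ)) (3 / 2 : ℂ) n‖ :=
    tsum_nonneg fun _ ↦ norm_nonneg _
  have hlogt : 0 ≤ Real.log |t| := Real.log_nonneg (by linarith)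
  have hlog4 : 0 ≤ Real.log (|t| + 4) := Real.log_nonneg (by linarith)
  have hCη : 0 ≤ Ch * Real.log (|t| + 4) / η := by positivity
  have hΛ₁0 : 0 ≤ Λ₁ := le_trans (by positivity) hΛ₁
  have hlogL : 0 ≤ Real.log (1 + 1 / L) := Real.log_nonneg (by
    have : 0 < 1 / L := by positivity
    linarith)
  have hlog3 : 0 ≤ Real.log 3 := Real.log_nonneg (by norm_num)
  set G : ℝ → ℂ := fun σ ↦
    (fun s : ℂ ↦ (-deriv riemannZeta s / riemannZeta s) * (x : ℂ) ^ s) ((σ : ℂ) + t * I) with hG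
  -- the majorant
  set A : ℝ := Λ₁ + 3 / 2 * (Real.log 3 + Real.log (1 + 1 / L)) with hA
  have hA0 : 0 ≤ A := by positivity
  set m : ℝ → ℝ := fun σ ↦ A * Real.exp (L * σ) + 3 / Real.exp 1 * Real.exp (L / 2 * σ) with hm
  have hGm : ∀ σ : ℝ, ‖G σ‖ ≤ m σ := by
    intro σ
    have h := norm_integrand_horizontal_le_cpow_log hCr hCh hx0 ht hη hη1 hZ hΛ₁ hCh0 hCr0 σ
    refine h.trans ?_
    have hw := max_neg_mul_exp_le (σ := σ) hL0
    have hl3 := log_three_add_le (le_max_right (-σ) 0) hL0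
    rw [hm]
    simp only
    rw [Real.rpow_def_of_pos hx0, ← hL]
    have hexp : 0 < Real.exp (L * σ) := Real.exp_pos _
    -- `(3/2) log(3 + max(-σ,0)) e^{Lσ} ≤ (3/2)(log 3 + log(1+1/L)) e^{Lσ} + (3/2) L max(-σ,0) e^{Lσ}`
    -- and `L max(-σ,0) e^{Lσ} ≤ (2/e) e^{Lσ/2}`
    have hkey : L * max (-σ) 0 * Real.exp (L * σ) ≤ 2 / Real.exp 1 * Real.exp (L / 2 * σ) := by
      have e1 : L * max (-σ) 0 * Real.exp (L * σ) = L / 5 * (5 * max (-σ) 0 * Real.exp (L * σ)) := by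
        ring
      rw [e1]
      calc L / 5 * (5 * max (-σ) 0 * Real.exp (L * σ))
          ≤ L / 5 * (10 / (Real.exp 1 * L) * Real.exp (L / 2 * σ)) :=
            mul_le_mul_of_nonneg_left hw (by positivity)
        _ = 2 / Real.exp 1 * Real.exp (L / 2 * σ) := by field_simp; ring
    have hexp2 : 0 < Real.exp (L / 2 * σ) := Real.exp_pos _
    calc (Λ₁ + 3 / 2 * Real.log (3 + max (-σ) 0)) * Real.exp (L * σ)
        ≤ (Λ₁ + 3 / 2 * (Real.log 3 + Real.log (1 + 1 / L) + L * max (-σ) 0)) * Real.exp (L * σ) := by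
          gcongr
      _ = A * Real.exp (L * σ) + 3 / 2 * (L * max (-σ) 0 * Real.exp (L * σ)) := by rw [hA]; ring
      _ ≤ A * Real.exp (L * σ) + 3 / 2 * (2 / Real.exp 1 * Real.exp (L / 2 * σ)) := by gcongr
      _ = A * Real.exp (L * σ) + 3 / Real.exp 1 * Real.exp (L / 2 * σ) := by ring
  have hGcont : Continuous G := continuous_integrand_horizontal_cpow hx0 ht0 hη hZ
  have h1 : IntegrableOn (fun σ : ℝ ↦ Real.exp (L * σ)) (Iic b) := integrableOn_exp_mul_Iic hL0 b
  have h2 : IntegrableOn (fun σ : ℝ ↦ Real.exp (L / 2 * σ)) (Iic b) :=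
    integrableOn_exp_mul_Iic (half_pos hL0) b
  have hm_int : Integrable m (volume.restrict (Iic b)) := (h1.const_mul A).add (h2.const_mul _)
  have hG_int : IntegrableOn G (Iic b) :=
    Integrable.mono' hm_int hGcont.aestronglyMeasurable (ae_of_all _ hGm)
  refine ⟨hG_int, ?_⟩
  have hint_m : ∫ σ in Iic b, m σ = A * (Real.exp (L * b) / L) +
      3 / Real.exp 1 * (Real.exp (L / 2 * b) / (L / 2)) := by
    rw [hm]
    simp only
    rw [MeasureTheory.integral_add (h1.const_mul A) (h2.const_mul _),
      MeasureTheory.integral_const_mul, MeasureTheory.integral_const_mul,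
      integral_exp_mul_Iic hL0, integral_exp_mul_Iic (half_pos hL0)]
  have hexb : Real.exp (L * b) = x ^ b := by
    rw [Real.rpow_def_of_pos hx0, hL]
  have hexb2 : Real.exp (L / 2 * b) ≤ x ^ b := by
    have e : Real.exp (L / 2 * b) = x ^ (b / 2) := by
      rw [Real.rpow_def_of_pos hx0, hL]; ring_nf
    rw [e]
    exact Real.rpow_le_rpow_of_exponent_le hx.le (by linarith)
  have he : (6 : ℝ) / Real.exp 1 ≤ 5 / 2 := by
    rw [div_le_iff₀ (Real.exp_pos 1)]
    have := Real.exp_one_gt_d9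
    linarith
  have hl3 : Real.log 3 ≤ 2 := by
    have := Real.log_le_sub_one_of_pos (show (0:ℝ) < 3 by norm_num); linarith
  have hxbpos : 0 < x ^ b := Real.rpow_pos_of_pos hx0 b
  calc ‖∫ σ in Iic b, G σ‖ ≤ ∫ σ in Iic b, m σ :=
        norm_integral_le_of_norm_le hm_int (ae_of_all _ hGm)
    _ = (A * x ^ b + 6 / Real.exp 1 * Real.exp (L / 2 * b)) / L := by
        rw [hint_m, hexb]; field_simp; ring
    _ ≤ (A * x ^ b + 5 / 2 * x ^ b) / L :=
        div_le_div_of_nonneg_right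
          (by nlinarith [mul_le_mul he hexb2 (Real.exp_pos _).le (by norm_num : (0:ℝ) ≤ 5 / 2)])
          hL0.le
    _ ≤ x ^ b * (Λ₁ + 6 + 3 / 2 * Real.log (1 + 1 / L)) / L := by
        apply div_le_div_of_nonneg_right _ hL0.le
        rw [hA]; nlinarith [hxbpos, hlogL, hl3]


/-! ### The terms `Λ(n) (x/n)^{b+it}` for a real exponent `b` -/

/-- `y^{b+it} = y^b · y^{it}` (`y > 0`, `b` real). [folklore] -/
private theorem cpow_ofReal_add {y : ℝ} (hy : 0 < y) (b t : ℝ) :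
    ((y : ℝ) : ℂ) ^ (((b : ℝ) : ℂ) + (t : ℂ) * I) = ((y ^ b : ℝ) : ℂ) * (y : ℂ) ^ ((t : ℂ) * I) := by
  rw [cpow_add _ _ (by exact_mod_cast hy.ne'), ← ofReal_cpow hy.le]

/-- `‖Λ(n) (x/n)^{b+it}‖ ≤ Λ(n) (x/n)^b`. [folklore] -/
private theorem norm_term_rpow_le {x : ℝ} (hx : 0 < x) (b : ℝ) (hb : 0 < b) (n : ℕ) (t : ℝ) :
    ‖(Λ n : ℂ) * (((x / n : ℝ)) : ℂ) ^ (((b : ℝ) : ℂ) + (t : ℂ) * I)‖ ≤ Λ n * (x / n) ^ b := by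
  rcases Nat.eq_zero_or_pos n with rfl | hn
  · have hb0 : ((b : ℝ) : ℂ) + (t : ℂ) * I ≠ 0 := fun h ↦ by
      have := congrArg Complex.re h; simp at this; linarith
    simp [zero_cpow hb0]
  · have hy : 0 < x / n := div_pos hx (by exact_mod_cast hn)
    have h1 : ‖((x / n : ℝ) : ℂ) ^ ((t : ℂ) * I)‖ = 1 := by
      rw [Complex.norm_cpow_eq_rpow_re_of_pos hy]; simp
    rw [norm_mul, cpow_ofReal_add hy, norm_mul, h1, mul_one, norm_real,
      Real.norm_eq_abs, abs_of_nonneg vonMangoldt_nonneg, norm_real, Real.norm_eq_abs,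
      abs_of_nonneg (Real.rpow_nonneg hy.le b)]

/-- Continuity in `t` of `Λ(n) (x/n)^{b+it}` (`b ≠ 0`). [folklore] -/
private theorem continuous_term_rpow (x b : ℝ) (hb : b ≠ 0) (n : ℕ) :
    Continuous fun t : ℝ ↦ (Λ n : ℂ) * (((x / n : ℝ)) : ℂ) ^ (((b : ℝ) : ℂ) + (t : ℂ) * I) := by
  refine continuous_const.mul (Continuous.const_cpow (by fun_prop) (Or.inr fun t h ↦ ?_))
  have := congrArg Complex.re h
  simp at this
  exact hb this

/-- For `0 < y < 2` and `0 < b ≤ 2`: `y^b ≤ 4`. [folklore] -/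
private theorem rpow_le_four {y b : ℝ} (hy : 0 < y) (hy2 : y < 2) (hb : 0 < b) (hb2 : b ≤ 2) : y ^ b ≤ 4 := by
  rcases le_or_gt 1 y with h1 | h1
  · calc y ^ b ≤ (2 : ℝ) ^ b := Real.rpow_le_rpow hy.le hy2.le hb.le
      _ ≤ (2 : ℝ) ^ (2 : ℝ) := Real.rpow_le_rpow_of_exponent_le (by norm_num) hb2
      _ = 4 := by norm_num
  · calc y ^ b ≤ 1 := Real.rpow_le_one hy.le h1.le hb.le
      _ ≤ 4 := by norm_num

/-- `x^{1 + 1/log(3x)} ≤ 3x` for `x > 1` (`x^{1/log 3x} = e^{log x/log 3x} ≤ e < 3`). [folklore] -/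
private theorem rpow_one_add_inv_log_le {x : ℝ} (hx : 1 < x) : x ^ (1 + 1 / Real.log (3 * x)) ≤ 3 * x := by
  have hx0 : 0 < x := by linarith
  have hL1 : 1 < Real.log (3 * x) := one_lt_log_three_mul hx
  have hlogx : 0 < Real.log x := Real.log_pos hx
  have hle : Real.log x ≤ Real.log (3 * x) := Real.log_le_log hx0 (by linarith)
  rw [Real.rpow_add hx0, Real.rpow_one, mul_comm]
  refine mul_le_mul_of_nonneg_right ?_ hx0.le
  rw [Real.rpow_def_of_pos hx0]
  have h1 : Real.log x * (1 / Real.log (3 * x)) ≤ 1 := by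
    rw [mul_one_div, div_le_one (by linarith)]; exact hle
  calc Real.exp (Real.log x * (1 / Real.log (3 * x))) ≤ Real.exp 1 := Real.exp_le_exp.2 h1
    _ ≤ 3 := by have := Real.exp_one_lt_d9; linarith

set_option maxHeartbeats 1600000 in
/-- **The Dirichlet-series side of Landau's formula on the line `Re s = 1 + 1/log(3x)`, linear in
`x`.** There is an absolute `C > 0` such that for all `x > 1` and `T > 0`, with `b = 1 + 1/log(3x)`,
`‖∫_{−T}^{T} (−ζ'/ζ)(b+it) x^{b+it} dt − 2T Λ(x)‖ ≤ C (x log²(3x) + log(3x) · min(T, x/⟨x⟩))`,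
where `Λ(x) = Λ(n)` if `x = n` is an integer and `Λ(x) = 0` otherwise, and `⟨x⟩ = primePowDist x`:
termwise integration of `∑ Λ(n)(x/n)^s`, the term `n = x` giving `2T Λ(x)`, the others
`≤ Λ(n)(x/n)^b min(2T, 2/|log(x/n)|)`, with `|log(x/n)| ≥ log 2` off `(x/2, 2x)` (total
`≪ x^b ∑Λ(n)n^{−b} ≪ x log 3x`), `≥ |x − n|/(2x)` for `|x − n| ≥ 1` (total `≪ x log(3x) ∑ 1/|x−n| ≪ x log²(3x)`),
and `≥ ⟨x⟩/(2x)` for the at most two prime powers `n ∈ {⌊x⌋, ⌈x⌉}`, `n ≠ x` (Gonek's choice of the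
line; no Brun–Titchmarsh). [cite: Gonek1993, Thm. 1 (proof)] -/
theorem rightLine_bound_linear :
    ∃ C : ℝ, 0 < C ∧ ∀ x : ℝ, 1 < x → ∀ T : ℝ, 0 < T →
      ‖(∫ t in (-T)..T, (fun s : ℂ ↦ (-deriv riemannZeta s / riemannZeta s) * (x : ℂ) ^ s)
            ((((1 + 1 / Real.log (3 * x) : ℝ)) : ℂ) + t * I)) -
          ((2 * T * (if ((⌊x⌋₊ : ℕ) : ℝ) = x then Λ ⌊x⌋₊ else 0) : ℝ) : ℂ)‖ ≤
        C * (x * Real.log (3 * x) ^ 2 + Real.log (3 * x) * min T (x / primePowDist x)) := by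
  obtain ⟨K₀, hK₀0, hK₀⟩ := exists_tsum_vonMangoldt_div_rpow_le'
  refine ⟨9 * (1 + K₀) + 96 + 32, by positivity, fun x hx T hT ↦ ?_⟩
  classical
  have hx0 : 0 < x := by linarith
  set L : ℝ := Real.log (3 * x) with hL
  have hL1 : 1 < L := one_lt_log_three_mul hx
  have hL0 : 0 < L := by linarith
  have hlog2x : Real.log (2 * x) ≤ L := Real.log_le_log (by positivity) (by linarith)
  have hlogx : Real.log x ≤ L := Real.log_le_log hx0 (by linarith)
  have hlog2x1 : Real.log (2 * x + 1) ≤ L := Real.log_le_log (by positivity) (by linarith)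
  set b : ℝ := 1 + 1 / L with hb
  have hb1 : 1 < b := by
    have : 0 < 1 / L := by positivity
    rw [hb]; linarith
  have hb0 : 0 < b := by linarith
  have hb2 : b ≤ 2 := by
    rw [hb]; have : 1 / L ≤ 1 := by rw [div_le_one hL0]; exact hL1.le
    linarith
  have hxb : x ^ b ≤ 3 * x := by rw [hb, hL]; exact rpow_one_add_inv_log_le hx
  obtain ⟨hsumb, htsumb⟩ := hK₀ b hb1
  have hmax : max (1 / (b - 1)) 1 = L := by
    rw [hb, show (1 : ℝ) + 1 / L - 1 = 1 / L by ring, one_div_one_div]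
    exact max_eq_left hL1.le
  rw [hmax] at htsumb
  set S : ℝ := ∑' n : ℕ, Λ n / (n : ℝ) ^ b with hS
  have hS0 : 0 ≤ S := tsum_nonneg fun n ↦ div_nonneg vonMangoldt_nonneg (by positivity)
  set m : ℝ := min T (x / primePowDist x) with hm
  have hpd := primePowDist_pos x
  have hm0 : 0 ≤ m := le_min hT.le (by positivity)
  -- the two finite sets of near terms
  set N₂ : Finset ℕ := (Finset.range (2 * ⌈x⌉₊)).filter
    (fun n : ℕ ↦ x / 2 < n ∧ (n : ℝ) < 2 * x ∧ 1 ≤ |x - n|) with hN₂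
  set N₃ : Finset ℕ := {⌊x⌋₊, ⌈x⌉₊} with hN₃
  have hcard₃ : (N₃.card : ℝ) ≤ 2 := by
    have : N₃.card ≤ 2 := by rw [hN₃]; exact Finset.card_le_two
    exact_mod_cast this
  -- the harmonic sum over `N₂`
  have hharm : ∑ n ∈ N₂, 1 / |x - (n : ℝ)| ≤ 3 * L + 3 := by
    have hsplit : ∑ n ∈ N₂, 1 / |x - (n : ℝ)| =
        ∑ n ∈ N₂.filter (fun n : ℕ ↦ (n : ℝ) < x), 1 / |x - (n : ℝ)| +
          ∑ n ∈ N₂.filter (fun n : ℕ ↦ ¬ (n : ℝ) < x), 1 / |x - (n : ℝ)| :=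
      (Finset.sum_filter_add_sum_filter_not N₂ _ _).symm
    have hleft : ∑ n ∈ N₂.filter (fun n : ℕ ↦ (n : ℝ) < x), 1 / |x - (n : ℝ)| ≤ 1 + Real.log x := by
      have hle := sum_inv_sub_left_le hx.le N₂
      have hset : N₂.filter (fun n : ℕ ↦ (n : ℝ) < x) =
          N₂.filter (fun n : ℕ ↦ (n : ℝ) < x ∧ 1 ≤ x - n) := by
        ext n
        simp only [hN₂, Finset.mem_filter, Finset.mem_range]
        constructor
        · rintro ⟨⟨hr, h1, h2, h3⟩, hlt⟩
          refine ⟨⟨hr, h1, h2, h3⟩, hlt, ?_⟩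
          rwa [abs_of_pos (by linarith)] at h3
        · rintro ⟨h, hlt, -⟩; exact ⟨h, hlt⟩
      rw [hset]
      refine le_trans (le_of_eq ?_) hle
      refine Finset.sum_congr rfl fun n hn ↦ ?_
      rw [Finset.mem_filter] at hn
      rw [abs_of_pos (by linarith [hn.2.1])]
    have hright : ∑ n ∈ N₂.filter (fun n : ℕ ↦ ¬ (n : ℝ) < x), 1 / |x - (n : ℝ)| ≤
        2 * (1 + Real.log (2 * x + 1)) := by
      have hle := sum_inv_sub_right_le hx0.le N₂
      have hset : N₂.filter (fun n : ℕ ↦ ¬ (n : ℝ) < x) =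
          N₂.filter (fun n : ℕ ↦ x < n ∧ 1 ≤ (n : ℝ) - x ∧ (n : ℝ) < 2 * x) := by
        ext n
        simp only [hN₂, Finset.mem_filter, Finset.mem_range, not_lt]
        constructor
        · rintro ⟨⟨hr, h1, h2, h3⟩, hge⟩
          have hne : (n : ℝ) ≠ x := by
            intro h; rw [h, sub_self, abs_zero] at h3; linarith
          have hgt : x < n := lt_of_le_of_ne hge (Ne.symm hne)
          refine ⟨⟨hr, h1, h2, h3⟩, hgt, ?_, h2⟩
          rwa [abs_of_neg (by linarith), neg_sub] at h3
        · rintro ⟨h, hgt, -, -⟩; exact ⟨h, hgt.le⟩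
      rw [hset]
      refine le_trans (le_of_eq ?_) hle
      refine Finset.sum_congr rfl fun n hn ↦ ?_
      rw [Finset.mem_filter] at hn
      rw [abs_of_neg (by linarith [hn.2.1]), neg_sub]
    rw [hsplit]
    linarith
  -- the termwise data
  set F : ℕ → ℝ → ℂ := fun n t ↦ (Λ n : ℂ) * (((x / n : ℝ)) : ℂ) ^ (((b : ℝ) : ℂ) + (t : ℂ) * I)
    with hF
  set f : ℝ → ℂ := fun t ↦ (fun s : ℂ ↦ (-deriv riemannZeta s / riemannZeta s) * (x : ℂ) ^ s)
    (((b : ℝ) : ℂ) + t * I) with hf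
  -- the dominating series `Λ(n) (x/n)^b = x^b Λ(n)/n^b`
  have hbound_eq : ∀ n : ℕ, Λ n * (x / n) ^ b = x ^ b * (Λ n / (n : ℝ) ^ b) := by
    intro n
    rcases Nat.eq_zero_or_pos n with rfl | hn
    · simp [Real.zero_rpow hb0.ne']
    · have hn0 : (0 : ℝ) < n := by exact_mod_cast hn
      rw [Real.div_rpow hx0.le hn0.le]
      have : (n : ℝ) ^ b ≠ 0 := (Real.rpow_pos_of_pos hn0 b).ne'
      field_simp
  have hbsum : Summable fun n : ℕ ↦ Λ n * (x / n) ^ b :=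
    (hsumb.mul_left (x ^ b)).congr fun n ↦ (hbound_eq n).symm
  have hbhas : HasSum (fun n : ℕ ↦ Λ n * (x / n) ^ b) (x ^ b * S) :=
    (hsumb.hasSum.mul_left (x ^ b)).congr_fun fun n ↦ (hbound_eq n)
  -- (1) termwise integration
  have hDCT : HasSum (fun n ↦ ∫ t in (-T)..T, F n t) (∫ t in (-T)..T, f t) := by
    refine intervalIntegral.hasSum_integral_of_dominated_convergence
      (fun n _ ↦ Λ n * (x / n) ^ b)
      (fun n ↦ (continuous_term_rpow x b hb0.ne' n).aestronglyMeasurable)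
      (fun n ↦ Eventually.of_forall fun t _ ↦ norm_term_rpow_le hx0 b hb0 n t)
      (Eventually.of_forall fun t _ ↦ hbsum) intervalIntegrable_const
      (Eventually.of_forall fun t _ ↦ ?_)
    have hs : 1 < (((b : ℝ) : ℂ) + t * I).re := by simp; exact hb1
    exact hasSum_vonMangoldt_mul_cpow hx0 hs
  -- (2) the main term
  set main : ℕ → ℂ := fun n ↦ if (n : ℝ) = x then (((2 * T * Λ n : ℝ)) : ℂ) else 0 with hmain
  have hmain0 : ∀ n : ℕ, n ≠ ⌊x⌋₊ → main n = 0 := by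
    intro n hn
    have h : ¬ ((n : ℝ) = x) := fun h ↦ hn (by rw [← h, Nat.floor_natCast])
    simp only [hmain, if_neg h]
  have hmainsum : HasSum main (((2 * T * (if ((⌊x⌋₊ : ℕ) : ℝ) = x then Λ ⌊x⌋₊ else 0) : ℝ)) : ℂ) := by
    have h := hasSum_single (f := main) ⌊x⌋₊ (fun n hn ↦ hmain0 n hn)
    have hval : main ⌊x⌋₊ = (((2 * T * (if ((⌊x⌋₊ : ℕ) : ℝ) = x then Λ ⌊x⌋₊ else 0) : ℝ)) : ℂ) := by
      simp only [hmain]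
      split_ifs <;> simp
    rwa [hval] at h
  -- (3) the termwise majorant
  set g : ℕ → ℝ := fun n ↦ 3 * (Λ n * (x / n) ^ b) + (if n ∈ N₂ then 16 * x * L / |x - (n : ℝ)| else 0) +
    (if n ∈ N₃ then 16 * L * m else 0) with hg
  have hg₁ : ∀ n, 0 ≤ 3 * (Λ n * (x / n) ^ b) := fun n ↦
    mul_nonneg (by norm_num) (mul_nonneg vonMangoldt_nonneg
      (Real.rpow_nonneg (div_nonneg hx0.le (Nat.cast_nonneg n)) b))
  have hg₂ : ∀ n, 0 ≤ (if n ∈ N₂ then 16 * x * L / |x - (n : ℝ)| else 0) := fun n ↦ by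
    split_ifs
    · positivity
    · exact le_rfl
  have hg₃ : ∀ n, 0 ≤ (if n ∈ N₃ then 16 * L * m else 0) := fun n ↦ by
    split_ifs
    · positivity
    · exact le_rfl
  have hgn0 : ∀ n, 0 ≤ g n := fun n ↦ by
    simp only [hg]
    linarith [hg₁ n, hg₂ n, hg₃ n]
  have hgsum : HasSum g (3 * (x ^ b * S) + ∑ n ∈ N₂, 16 * x * L / |x - (n : ℝ)| +
      (N₃.card : ℝ) * (16 * L * m)) := by
    have h2 : HasSum (fun n : ℕ ↦ if n ∈ N₂ then 16 * x * L / |x - (n : ℝ)| else 0)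
        (∑ n ∈ N₂, 16 * x * L / |x - (n : ℝ)|) := by
      have h : HasSum (fun n : ℕ ↦ if n ∈ N₂ then 16 * x * L / |x - (n : ℝ)| else 0)
          (∑ n ∈ N₂, if n ∈ N₂ then 16 * x * L / |x - (n : ℝ)| else 0) :=
        hasSum_sum_of_ne_finset_zero (fun n hn ↦ if_neg hn)
      rwa [Finset.sum_congr rfl (fun n hn ↦ if_pos hn)] at h
    have h3 : HasSum (fun n : ℕ ↦ if n ∈ N₃ then 16 * L * m else 0) ((N₃.card : ℝ) * (16 * L * m)) := by
      have h : HasSum (fun n : ℕ ↦ if n ∈ N₃ then 16 * L * m else 0)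
          (∑ n ∈ N₃, if n ∈ N₃ then 16 * L * m else 0) :=
        hasSum_sum_of_ne_finset_zero (fun n hn ↦ if_neg hn)
      rwa [Finset.sum_congr rfl (fun n hn ↦ if_pos hn), Finset.sum_const, nsmul_eq_mul] at h
    exact ((hbhas.mul_left 3).add h2).add h3
  have hterm : ∀ n : ℕ, ‖(∫ t in (-T)..T, F n t) - main n‖ ≤ g n := by
    intro n
    rcases Nat.eq_zero_or_pos n with rfl | hn
    · -- `n = 0`
      have h0 : main 0 = 0 := hmain0 0 (by
        intro h
        have : 0 < ⌊x⌋₊ := Nat.floor_pos.2 hx.le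
        omega)
      rw [h0, sub_zero]
      have hb0' : ((b : ℝ) : ℂ) ≠ 0 := by exact_mod_cast hb0.ne'
      have : ∀ t : ℝ, F 0 t = 0 := fun t ↦ by
        simp only [hF, Nat.cast_zero, div_zero, ofReal_zero]
        rw [zero_cpow (fun h ↦ by have := congrArg Complex.re h; simp at this; linarith), mul_zero]
      simp only [this, intervalIntegral.integral_zero, norm_zero]
      exact hgn0 0
    have hnpos : (0 : ℝ) < n := by exact_mod_cast hn
    have hy : 0 < x / n := div_pos hx0 hnpos
    -- the integral of the `n`-th term
    have hint : ∫ t in (-T)..T, F n t =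
        (Λ n : ℂ) * ((((x / n) ^ b : ℝ)) : ℂ) * ∫ t in (-T)..T, ((x / n : ℝ) : ℂ) ^ ((t : ℂ) * I) := by
      simp only [hF, cpow_ofReal_add hy]
      rw [← intervalIntegral.integral_const_mul]
      refine intervalIntegral.integral_congr fun t _ ↦ ?_
      ring
    have hΛn0 : 0 ≤ Λ n := vonMangoldt_nonneg
    have hxn0 : 0 ≤ (x / n) ^ b := Real.rpow_nonneg hy.le b
    by_cases hnx : (n : ℝ) = x
    · -- the main term `n = x`
      have hy1 : x / n = 1 := by rw [hnx, div_self hx0.ne']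
      have hmn : main n = (((2 * T * Λ n : ℝ)) : ℂ) := by simp only [hmain, if_pos hnx]
      rw [hint, hmn, hy1, integral_one_cpow_mul_I, Real.one_rpow]
      have : (Λ n : ℂ) * (((1 : ℝ)) : ℂ) * (2 * (T : ℂ)) - (((2 * T * Λ n : ℝ)) : ℂ) = 0 := by
        push_cast; ring
      rw [this, norm_zero]
      exact hgn0 n
    · have hmn : main n = 0 := by simp only [hmain, if_neg hnx]
      rw [hmn, sub_zero, hint, norm_mul, norm_mul, norm_real, Real.norm_eq_abs,
        abs_of_nonneg vonMangoldt_nonneg, norm_real, Real.norm_eq_abs, abs_of_nonneg hxn0]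
      by_cases hΛ : Λ n = 0
      · rw [hΛ]; simpa using hgn0 n
      have hpp : IsPrimePow n := vonMangoldt_ne_zero_iff.1 hΛ
      have hy1 : x / n ≠ 1 := fun h ↦ hnx (by rw [div_eq_one_iff_eq hnpos.ne'] at h; exact h.symm)
      have hosc := norm_integral_cpow_mul_I_le hy hy1 hT.le
      have hosc0 : 0 ≤ ‖∫ t in (-T)..T, ((x / n : ℝ) : ℂ) ^ ((t : ℂ) * I)‖ := norm_nonneg _
      by_cases hnear : x / 2 < n ∧ (n : ℝ) < 2 * x
      · -- near `x`: `(x/n)^b ≤ 4`, `Λ(n) ≤ log(2x) ≤ L`, `|log(x/n)| ≥ |x − n|/(2x)`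
        have hlog := abs_sub_div_le_abs_log hx0 hnear.1 hnear.2
        have hxn4 : (x / n) ^ b ≤ 4 := by
          have h1 : x / n < 2 := by rw [div_lt_iff₀ hnpos]; linarith [hnear.1]
          exact rpow_le_four hy h1 hb0 hb2
        have hΛL : Λ n ≤ L := by
          calc Λ n ≤ Real.log n := vonMangoldt_le_log
            _ ≤ Real.log (2 * x) := Real.log_le_log hnpos hnear.2.le
            _ ≤ L := hlog2x
        have habs0 : 0 < |x - n| := abs_pos.2 (sub_ne_zero.2 (Ne.symm hnx))
        have hlogpos : 0 < |Real.log (x / n)| := lt_of_lt_of_le (by positivity) hlog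
        by_cases hfar1 : 1 ≤ |x - n|
        · -- `|x − n| ≥ 1`: the oscillatory integral is `≤ 4x/|x−n|`
          have h1 : 2 / |Real.log (x / n)| ≤ 4 * x / |x - n| := by
            rw [div_le_div_iff₀ hlogpos habs0]
            have h3 : |x - n| ≤ 2 * x * |Real.log (x / n)| := by
              rwa [div_le_iff₀ (by positivity), mul_comm] at hlog
            nlinarith
          have h4 : min (2 * T) (2 / |Real.log (x / n)|) ≤ 4 * x / |x - n| := (min_le_right _ _).trans h1
          have hmem : n ∈ N₂ := by
            rw [hN₂, Finset.mem_filter, Finset.mem_range]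
            refine ⟨?_, hnear.1, hnear.2, hfar1⟩
            have hc : x ≤ ⌈x⌉₊ := Nat.le_ceil x
            have : (n : ℝ) < 2 * (⌈x⌉₊ : ℝ) := by linarith [hnear.2]
            exact_mod_cast this
          have hval : 16 * x * L / |x - (n : ℝ)| ≤ g n := by
            simp only [hg, if_pos hmem]
            linarith [hg₁ n, hg₃ n]
          refine le_trans ?_ hval
          calc Λ n * (x / n) ^ b * ‖∫ t in (-T)..T, ((x / n : ℝ) : ℂ) ^ ((t : ℂ) * I)‖
              ≤ L * 4 * (4 * x / |x - n|) := by
                refine mul_le_mul (mul_le_mul hΛL hxn4 hxn0 hL0.le) (hosc.trans h4) hosc0 ?_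
                positivity
            _ = 16 * x * L / |x - (n : ℝ)| := by ring
        · -- `|x − n| < 1`: `n ∈ {⌊x⌋, ⌈x⌉}` and `|log(x/n)| ≥ ⟨x⟩/(2x)`
          push Not at hfar1
          have hmem : n ∈ N₃ := by
            rw [hN₃, Finset.mem_insert, Finset.mem_singleton]
            exact eq_floor_or_ceil_of_abs_sub_lt_one hx0.le hfar1
          have hdist := primePowDist_le (x := x) hpp hnx
          have h1 : 2 / |Real.log (x / n)| ≤ 4 * (x / primePowDist x) := by
            rw [div_le_iff₀ hlogpos]
            have h2 : primePowDist x / (2 * x) ≤ |Real.log (x / n)| :=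
              le_trans (div_le_div_of_nonneg_right hdist (by positivity)) hlog
            have h3 : primePowDist x ≤ 2 * x * |Real.log (x / n)| := by
              rwa [div_le_iff₀ (by positivity), mul_comm] at h2
            calc (2 : ℝ) = 2 * primePowDist x * (1 / primePowDist x) := by field_simp
              _ ≤ 2 * (2 * x * |Real.log (x / n)|) * (1 / primePowDist x) := by gcongr
              _ = 4 * (x / primePowDist x) * |Real.log (x / n)| := by ring
          have h4 : min (2 * T) (2 / |Real.log (x / n)|) ≤ 4 * m := by
            rw [hm]
            rcases le_total T (x / primePowDist x) with h | h
            · rw [min_eq_left h]; exact (min_le_left _ _).trans (by linarith)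
            · rw [min_eq_right h]; exact (min_le_right _ _).trans h1
          have hval : 16 * L * m ≤ g n := by
            simp only [hg, if_pos hmem]
            linarith [hg₁ n, hg₂ n]
          refine le_trans ?_ hval
          calc Λ n * (x / n) ^ b * ‖∫ t in (-T)..T, ((x / n : ℝ) : ℂ) ^ ((t : ℂ) * I)‖
              ≤ L * 4 * (4 * m) := by
                refine mul_le_mul (mul_le_mul hΛL hxn4 hxn0 hL0.le) (hosc.trans h4) hosc0 ?_
                positivity
            _ = 16 * L * m := by ring
      · -- far from `x`: `|log(x/n)| ≥ log 2`
        have hlog2 : Real.log 2 ≤ |Real.log (x / n)| := by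
          rw [not_and_or] at hnear
          rcases hnear with h | h
          · push Not at h
            have h2 : 2 ≤ x / n := by rw [le_div_iff₀ hnpos]; linarith
            calc Real.log 2 ≤ Real.log (x / n) := Real.log_le_log two_pos h2
              _ ≤ |Real.log (x / n)| := le_abs_self _
          · push Not at h
            have h2 : 2 ≤ n / x := by rw [le_div_iff₀ hx0]; linarith
            calc Real.log 2 ≤ Real.log (n / x) := Real.log_le_log two_pos h2
              _ = -Real.log (x / n) := by rw [← Real.log_inv, inv_div]
              _ ≤ |Real.log (x / n)| := neg_le_abs _
        have hl2 : (2 : ℝ) / 3 < Real.log 2 := by linarith [Real.log_two_gt_d9]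
        have h1 : 2 / |Real.log (x / n)| ≤ 3 := by
          rw [div_le_iff₀ (lt_of_lt_of_le (by positivity) hlog2)]
          linarith
        have h4 : min (2 * T) (2 / |Real.log (x / n)|) ≤ 3 := (min_le_right _ _).trans h1
        have hval : 3 * (Λ n * (x / n) ^ b) ≤ g n := by
          simp only [hg]
          linarith [hg₂ n, hg₃ n]
        refine le_trans ?_ hval
        calc Λ n * (x / n) ^ b * ‖∫ t in (-T)..T, ((x / n : ℝ) : ℂ) ^ ((t : ℂ) * I)‖
            ≤ Λ n * (x / n) ^ b * 3 :=
              mul_le_mul_of_nonneg_left (hosc.trans h4) (mul_nonneg hΛn0 hxn0)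
          _ = 3 * (Λ n * (x / n) ^ b) := by ring
  -- (4) summation
  have hdiff := hDCT.sub hmainsum
  have hle := HasSum.norm_le_of_bounded hdiff hgsum hterm
  refine hle.trans ?_
  have h1 : 3 * (x ^ b * S) ≤ 9 * (1 + K₀) * (x * L ^ 2) := by
    calc 3 * (x ^ b * S) ≤ 3 * ((3 * x) * (L + K₀)) := by gcongr
      _ = 9 * (x * L) + 9 * K₀ * x := by ring
      _ ≤ 9 * (x * L ^ 2) + 9 * K₀ * (x * L ^ 2) := by
          have hLL : L ≤ L ^ 2 := by nlinarith
          have hxL2 : x ≤ x * L ^ 2 := le_mul_of_one_le_right hx0.le (by nlinarith)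
          gcongr
      _ = 9 * (1 + K₀) * (x * L ^ 2) := by ring
  have h2 : ∑ n ∈ N₂, 16 * x * L / |x - (n : ℝ)| ≤ 96 * (x * L ^ 2) := by
    have e : ∑ n ∈ N₂, 16 * x * L / |x - (n : ℝ)| = 16 * x * L * ∑ n ∈ N₂, 1 / |x - (n : ℝ)| := by
      rw [Finset.mul_sum]
      exact Finset.sum_congr rfl fun n _ ↦ by ring
    rw [e]
    calc 16 * x * L * ∑ n ∈ N₂, 1 / |x - (n : ℝ)| ≤ 16 * x * L * (3 * L + 3) :=
          mul_le_mul_of_nonneg_left hharm (by positivity)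
      _ ≤ 16 * x * L * (6 * L) := by gcongr; linarith
      _ = 96 * (x * L ^ 2) := by ring
  have h3 : (N₃.card : ℝ) * (16 * L * m) ≤ 32 * (L * m) := by
    calc (N₃.card : ℝ) * (16 * L * m) ≤ 2 * (16 * L * m) :=
          mul_le_mul_of_nonneg_right hcard₃ (by positivity)
      _ = 32 * (L * m) := by ring
  have hLm : 0 ≤ L * m := by positivity
  have hxL : 0 ≤ x * L ^ 2 := by positivity
  nlinarith [h1, h2, h3, hLm, hxL, hK₀0]


/-! ### Landau's formula, error linear in `x` -/

set_option maxHeartbeats 1600000 in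
/-- **Landau's formula, uniformly in `x`, with error linear in `x`.** There is an absolute constant
`C` such that for all real `x > 1` and `T ≥ 2`,
`‖∑_{|Im ρ| ≤ T} m(ρ) x^ρ + (T/π) Λ(x)‖
  ≤ C (x (log²T + log(1 + 1/log x)) (1 + 1/log x) + x log²(3x) + log(3x)·min(T, x/⟨x⟩))`,
where the sum runs over the non-trivial zeros `ρ` of `ζ` with `|Im ρ| ≤ T` (the finite set
`weilZeroIndex T`) counted with multiplicity `m(ρ) = riemannZetaZeroOrder ρ`,
`Λ(x) = Λ(n)` if `x = n ∈ ℕ` and `Λ(x) = 0` otherwise, and `⟨x⟩ = primePowDist x` is the distance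
from `x` to the nearest prime power other than `x`. A corollary of Gonek's Theorem 1, whose error
`O(x log(2xT) loglog 3x) + O(log x · min(T, x/⟨x⟩)) + O(log 2T · min(T, 1/log x))` it dominates term
by term (our `x log²T/log x` for Gonek's `log 2T · min(T, 1/log x)` when `log x ≥ 1/T`).
[cite: Gonek1993, Thm. 1] -/
theorem landau_gonek_formula_linear :
    ∃ C : ℝ, 0 < C ∧ ∀ x : ℝ, 1 < x → ∀ T : ℝ, 2 ≤ T →
      ‖∑ ρ ∈ (weilZeroIndex_finite T).toFinset, (riemannZetaZeroOrder ρ : ℂ) * (x : ℂ) ^ ρ +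
          (((T / π * (if ((⌊x⌋₊ : ℕ) : ℝ) = x then Λ ⌊x⌋₊ else 0)) : ℝ) : ℂ)‖ ≤
        C * (x * (Real.log T ^ 2 + Real.log (1 + 1 / Real.log x)) * (1 + 1 / Real.log x) +
          x * Real.log (3 * x) ^ 2 + Real.log (3 * x) * min T (x / primePowDist x)) := by
  -- constants
  obtain ⟨CR, hCR0, hRight⟩ := rightLine_bound_linear
  obtain ⟨Cr, hCr0, hCr⟩ := ZetaZeroSum.exists_norm_logDeriv_riemannXi_le_of_re_ge
  obtain ⟨Ch, hCh0, hCh⟩ := PsiOneExplicit.exists_norm_logDeriv_riemannZeta_horizontal_le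
  obtain ⟨c₀, hc₀0, hgoodH⟩ := exists_goodHeight_all
  obtain ⟨Cw, hCw0, hCw⟩ := exists_sum_zetaZeroWindow_le
  obtain ⟨δ, hδ0, hδ2, hgap⟩ := ZetaZeroSum.exists_gap_im
  set M₀ : ℝ := ∑' n : ℕ, ‖LSeries.term (fun n ↦ (ArithmeticFunction.vonMangoldt n : ℂ)) (3 / 2 : ℂ) n‖
    with hM₀
  have hM₀0 : 0 ≤ M₀ := tsum_nonneg fun _ ↦ norm_nonneg _
  set A₀ : ℝ := Cr + 12 + M₀ + 2 * Ch + Ch / c₀ with hA₀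
  have hA₀0 : 0 ≤ A₀ := by positivity
  refine ⟨164 + 2 * CR + 54 * A₀ + 24 * Cw, by positivity, fun x hx T hT ↦ ?_⟩
  classical
  -- basics
  have hx0 : 0 < x := by linarith
  set L : ℝ := Real.log x with hL
  have hL0 : 0 < L := Real.log_pos hx
  have hT0 : 0 < T := by linarith
  set Λr : ℝ := (if ((⌊x⌋₊ : ℕ) : ℝ) = x then Λ ⌊x⌋₊ else 0) with hΛr
  have hΛr0 : 0 ≤ Λr := by rw [hΛr]; split_ifs <;> simp [vonMangoldt_nonneg]
  have hΛrle : Λr ≤ x := by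
    rw [hΛr]
    split_ifs with h
    · calc Λ ⌊x⌋₊ ≤ Real.log (⌊x⌋₊ : ℝ) := vonMangoldt_le_log
        _ = L := by rw [h]
        _ ≤ x - 1 := Real.log_le_sub_one_of_pos hx0
        _ ≤ x := by linarith
    · exact hx0.le
  -- the abscissa of the right edge
  set L₃ : ℝ := Real.log (3 * x) with hL₃
  have hL₃1 : 1 < L₃ := one_lt_log_three_mul hx
  have hL₃0 : 0 < L₃ := by linarith
  set b : ℝ := 1 + 1 / L₃ with hb
  have hb1 : 1 < b := by
    have : 0 < 1 / L₃ := by positivity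
    rw [hb]; linarith
  have hb0 : 0 ≤ b := by linarith
  have hxb : x ^ b ≤ 3 * x := by rw [hb, hL₃]; exact rpow_one_add_inv_log_le hx
  -- a good height `T₁ ∈ [T, T+1]`
  obtain ⟨T₁, hT₁, hT₁', η, hη0, hη1, hηinv, hZ⟩ := hgoodH T (by linarith)
  have hT₁2 : 2 ≤ T₁ := hT.trans hT₁
  have hT₁0 : 0 < T₁ := by linarith
  have hgood : ∀ ρ ∈ RHWave0.riemannZetaNontrivialZeros, ρ.im ≠ T₁ ∧ ρ.im ≠ -T₁ := by
    intro ρ hρ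
    obtain ⟨h1, h2⟩ := hZ ρ hρ
    refine ⟨fun h ↦ ?_, fun h ↦ ?_⟩
    · rw [h, sub_self, abs_zero] at h1; linarith
    · rw [h, neg_add_cancel, abs_zero] at h2; linarith
  have hZtop : ∀ ρ ∈ RHWave0.riemannZetaNontrivialZeros, η ≤ |ρ.im - T₁| := fun ρ hρ ↦ (hZ ρ hρ).1
  have hZbot : ∀ ρ ∈ RHWave0.riemannZetaNontrivialZeros, η ≤ |ρ.im - (-T₁)| := fun ρ hρ ↦ by
    rw [sub_neg_eq_add]; exact (hZ ρ hρ).2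
  -- `Λ₁` and its size
  set ℓ : ℝ := Real.log (T₁ + 4) with hℓ
  have hℓ1 : 1 ≤ ℓ := by
    rw [hℓ, Real.le_log_iff_exp_le (by linarith)]
    have := Real.exp_one_lt_d9
    linarith
  set Λ₁ : ℝ := Cr + 10 + 3 / 2 * ℓ + Ch * ℓ * (2 + ℓ / c₀) + M₀ with hΛ₁def
  have habsT : |T₁| = T₁ := abs_of_pos hT₁0
  have habsT' : |(-T₁)| = T₁ := by rw [abs_neg, habsT]
  have hℓ0 : 0 ≤ ℓ := by linarith
  have hΛ₁ : ∀ t : ℝ, |t| = T₁ →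
      Cr + 10 + 3 / 2 * Real.log |t| + Ch * Real.log (|t| + 4) / η + M₀ ≤ Λ₁ := by
    intro t ht
    rw [ht, ← hℓ]
    have hlogT₁ : Real.log T₁ ≤ ℓ := Real.log_le_log hT₁0 (by linarith)
    have hlogT₁2 : Real.log (T₁ + 2) ≤ ℓ := Real.log_le_log (by linarith) (by linarith)
    have h1 : Ch * ℓ / η ≤ Ch * ℓ * (2 + ℓ / c₀) := by
      rw [div_eq_mul_one_div]
      refine mul_le_mul_of_nonneg_left (hηinv.trans ?_) (by positivity)
      gcongr
    linarith
  have hΛ₁A : Λ₁ ≤ A₀ * ℓ ^ 2 := by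
    rw [hΛ₁def, hA₀]
    have hℓ2 : ℓ ≤ ℓ ^ 2 := le_self_pow₀ hℓ1 two_ne_zero
    have h1 : (1 : ℝ) ≤ ℓ ^ 2 := one_le_pow₀ hℓ1
    have h2 : Ch * ℓ * (2 + ℓ / c₀) = 2 * Ch * ℓ + Ch / c₀ * ℓ ^ 2 := by ring
    rw [h2]
    have p1 : 0 ≤ Cr * (ℓ ^ 2 - 1) := mul_nonneg hCr0.le (by linarith)
    have p2 : 0 ≤ M₀ * (ℓ ^ 2 - 1) := mul_nonneg hM₀0 (by linarith)
    have p3 : 0 ≤ Ch * (ℓ ^ 2 - ℓ) := mul_nonneg hCh0.le (by linarith)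
    have p4 : 0 ≤ Ch / c₀ := by positivity
    nlinarith [mul_comm (Ch / c₀) (ℓ ^ 2)]
  -- `ℓ ≤ 3 log T`
  have hlogT : Real.log 2 ≤ Real.log T := Real.log_le_log two_pos hT
  have hlog2 : (1 / 2 : ℝ) < Real.log 2 := by have := Real.log_two_gt_d9; linarith
  have hlogT0 : 1 / 2 < Real.log T := by linarith
  have hℓ3 : ℓ ≤ 3 * Real.log T := by
    have h4 : ℓ ≤ Real.log (4 * T) := Real.log_le_log (by linarith) (by linarith)
    have h44 : Real.log (4 * T) = Real.log 4 + Real.log T := Real.log_mul (by norm_num) hT0.ne'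
    have hl4 : Real.log 4 = 2 * Real.log 2 := by
      rw [show (4 : ℝ) = 2 ^ 2 by norm_num, Real.log_pow]; norm_num
    linarith
  -- the two horizontal half-lines
  obtain ⟨hint_top, hHtop⟩ := horizontal_integral_bound_cpow_log hCr hCh hx hb0 (t := T₁)
    (by rw [habsT]; exact hT₁2) hη0 hη1 hZtop (hΛ₁ T₁ habsT) hCh0.le hCr0.le
  obtain ⟨hint_bot, hHbot⟩ := horizontal_integral_bound_cpow_log hCr hCh hx hb0 (t := -T₁)
    (by rw [habsT']; exact hT₁2) hη0 hη1 hZbot (hΛ₁ (-T₁) habsT') hCh0.le hCr0.le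
  -- the contour
  have hB := rightEdge_identity_cpow hx hb1 hδ0 hgap (by linarith : (1 : ℝ) ≤ T₁) hgood hint_top hint_bot
  -- the right line
  have hR := hRight x hx T₁ hT₁0
  -- the zeros between `T` and `T₁`
  have hS := norm_zeroSum_sub_le_cpow hx.le hT₁
  have hD := sum_order_sdiff_le hCw hT0.le hT₁'
  -- names
  set G : ℂ → ℂ := fun s ↦ (-deriv riemannZeta s / riemannZeta s) * (x : ℂ) ^ s with hG
  set V : ℂ := ∫ t in (-T₁)..T₁, G (((b : ℝ) : ℂ) + t * I) with hV
  set Hb : ℂ := ∫ σ in Iic b, G ((σ : ℂ) + (-T₁ : ℝ) * I) with hHb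
  set Ht : ℂ := ∫ σ in Iic b, G ((σ : ℂ) + T₁ * I) with hHt
  set S₁ : ℂ := ∑ ρ ∈ (weilZeroIndex_finite T₁).toFinset,
    (riemannZetaZeroOrder ρ : ℂ) * (x : ℂ) ^ ρ with hS₁
  set S : ℂ := ∑ ρ ∈ (weilZeroIndex_finite T).toFinset,
    (riemannZetaZeroOrder ρ : ℂ) * (x : ℂ) ^ ρ with hSdef
  set cx : ℂ := ((((x ^ 2 - 1)⁻¹ : ℝ)) : ℂ) with hcx
  set D : ℝ := ∑ ρ ∈ (weilZeroIndex_finite T₁).toFinset \ (weilZeroIndex_finite T).toFinset,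
    (riemannZetaZeroOrder ρ : ℝ) with hDdef
  have hπ0 : (0 : ℝ) < π := Real.pi_pos
  have hπC : (π : ℂ) ≠ 0 := by exact_mod_cast hπ0.ne'
  have hnorm2π : ‖(2 * π : ℂ)‖ = 2 * π := by
    rw [show (2 * π : ℂ) = ((2 * π : ℝ) : ℂ) by norm_cast, Complex.norm_real, Real.norm_eq_abs,
      abs_of_pos (by positivity)]
  -- `V = 2π (x − S₁ − cx) + i (Hb − Ht)`
  have hVeq : V = 2 * π * ((x : ℂ) - S₁ - cx) + I * (Hb - Ht) := by
    have hI : I * I = -1 := I_mul_I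
    have hB' : I * V = 2 * π * I * ((x : ℂ) - S₁ - cx) - Hb + Ht := by
      rw [hV, hHb, hHt, hS₁, hcx]
      exact hB
    linear_combination (-I) * hB' + (V - 2 * π * ((x : ℂ) - S₁ - cx)) * hI
  -- the right line in our names
  have hR' : ‖V - (((2 * T₁ * Λr : ℝ)) : ℂ)‖ ≤
      CR * (x * Real.log (3 * x) ^ 2 + Real.log (3 * x) * min T₁ (x / primePowDist x)) := by
    rw [hV, hΛr, hb, hL₃]; exact hR
  -- the target, decomposed
  have htarget : S + (((T / π * Λr : ℝ)) : ℂ) =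
      (S - S₁) + ((x : ℂ) - cx) - (V - (((2 * T₁ * Λr : ℝ)) : ℂ)) / (2 * π) +
        I * (Hb - Ht) / (2 * π) - ((((T₁ - T) / π * Λr : ℝ)) : ℂ) := by
    rw [hVeq]
    push_cast
    field_simp
    ring
  -- sizes: `W = x (log² T + lg)(1 + 1/L)`, `R = x log²(3x)`, `P = log(3x) min(T, x/⟨x⟩)`
  set lg : ℝ := Real.log (1 + 1 / L) with hlg
  have hlg0 : 0 ≤ lg := by
    apply Real.log_nonneg
    have : 0 < 1 / L := by positivity
    linarith
  set W : ℝ := x * (Real.log T ^ 2 + lg) * (1 + 1 / L) with hW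
  set R : ℝ := x * L₃ ^ 2 with hRdef
  set P : ℝ := L₃ * min T (x / primePowDist x) with hP
  have hpd := primePowDist_pos x
  have hmin0 : 0 ≤ min T (x / primePowDist x) := le_min hT0.le (by positivity)
  have hP0 : 0 ≤ P := by positivity
  have hR0 : 0 ≤ R := by positivity
  have h1L : 0 < 1 / L := by positivity
  have hW0 : 0 ≤ W := by positivity
  have hlogsq : 1 / 4 ≤ Real.log T ^ 2 :=
    calc (1 / 4 : ℝ) = (1 / 2) ^ 2 := by norm_num
      _ ≤ Real.log T ^ 2 := pow_le_pow_left₀ (by norm_num) hlogT0.le 2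
  -- basic comparisons with `W`
  have hWexp : W = x * Real.log T ^ 2 + x * lg + x * Real.log T ^ 2 * (1 / L) + x * lg * (1 / L) := by
    rw [hW]; ring
  have t1 : 0 ≤ x * Real.log T ^ 2 := by positivity
  have t2 : 0 ≤ x * lg := mul_nonneg hx0.le hlg0
  have t3 : 0 ≤ x * Real.log T ^ 2 * (1 / L) := by positivity
  have t4 : 0 ≤ x * lg * (1 / L) := mul_nonneg t2 h1L.le
  have hW1 : x * Real.log T ^ 2 ≤ W := by rw [hWexp]; linarith
  have hW2 : x * Real.log T ^ 2 / L ≤ W := by rw [div_eq_mul_one_div, hWexp]; linarith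
  have hW3 : x * lg / L ≤ W := by rw [div_eq_mul_one_div, hWexp]; linarith
  have hxW : x ≤ 4 * W := by
    calc x = 4 * (x * (1 / 4)) := by ring
      _ ≤ 4 * (x * Real.log T ^ 2) := by gcongr
      _ ≤ 4 * W := by linarith
  have hxLW : x / L ≤ 4 * W := by
    have : x / L ≤ 4 * (x * Real.log T ^ 2 / L) := by
      rw [show 4 * (x * Real.log T ^ 2 / L) = (4 * (x * Real.log T ^ 2)) / L by ring]
      exact div_le_div_of_nonneg_right (by nlinarith) hL0.le
    linarith
  have hcxW : (x ^ 2 - 1)⁻¹ ≤ 2 * W := by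
    have h1 : 2 * L ≤ x ^ 2 - 1 := two_mul_log_le_sq_sub_one hx0
    have h2 : (x ^ 2 - 1)⁻¹ ≤ (2 * L)⁻¹ := by
      rw [inv_le_inv₀ (by linarith) (by positivity)]; exact h1
    refine h2.trans ?_
    have h3 : (2 * L)⁻¹ = 1 / 2 * (1 / L) := by rw [mul_inv, one_div, one_div]
    have h4 : 1 / L ≤ x / L := div_le_div_of_nonneg_right hx.le hL0.le
    rw [h3]
    linarith
  have hL₃R : L₃ ≤ R := by
    rw [hRdef]
    have : 1 * L₃ ≤ x * L₃ := mul_le_mul_of_nonneg_right hx.le hL₃0.le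
    nlinarith
  have hx21 : 1 < x ^ 2 := one_lt_pow₀ hx two_ne_zero
  -- (i) `x − 1/(x²−1)`
  have h_i : ‖(x : ℂ) - cx‖ ≤ 6 * W := by
    have hcxn : ‖cx‖ = (x ^ 2 - 1)⁻¹ := by
      rw [hcx, Complex.norm_real, Real.norm_eq_abs, abs_of_pos (inv_pos.2 (sub_pos.2 hx21))]
    have hxn : ‖(x : ℂ)‖ = x := by rw [Complex.norm_real, Real.norm_eq_abs, abs_of_pos hx0]
    calc ‖(x : ℂ) - cx‖ ≤ ‖(x : ℂ)‖ + ‖cx‖ := norm_sub_le _ _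
      _ = x + (x ^ 2 - 1)⁻¹ := by rw [hxn, hcxn]
      _ ≤ 4 * W + 2 * W := add_le_add hxW hcxW
      _ = 6 * W := by ring
  -- (ii) the right line
  have hmin1 : min T₁ (x / primePowDist x) ≤ min T (x / primePowDist x) + 1 := by
    calc min T₁ (x / primePowDist x) ≤ min (T + 1) (x / primePowDist x + 1) :=
          min_le_min hT₁' (by linarith)
      _ = min T (x / primePowDist x) + 1 := min_add_add_right T (x / primePowDist x) 1
  have h_ii : ‖(V - (((2 * T₁ * Λr : ℝ)) : ℂ)) / (2 * π)‖ ≤ CR * (2 * R + P) := by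
    rw [norm_div, hnorm2π]
    have h2π : (1 : ℝ) ≤ 2 * π := by linarith [Real.pi_gt_three]
    calc ‖V - (((2 * T₁ * Λr : ℝ)) : ℂ)‖ / (2 * π) ≤ ‖V - (((2 * T₁ * Λr : ℝ)) : ℂ)‖ :=
          div_le_self (norm_nonneg _) h2π
      _ ≤ CR * (x * Real.log (3 * x) ^ 2 + Real.log (3 * x) * min T₁ (x / primePowDist x)) := hR'
      _ ≤ CR * (x * Real.log (3 * x) ^ 2 + Real.log (3 * x) * (min T (x / primePowDist x) + 1)) := by
          gcongr
      _ = CR * (R + L₃ + P) := by rw [hRdef, hP, hL₃]; ring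
      _ ≤ CR * (2 * R + P) := by
          refine mul_le_mul_of_nonneg_left ?_ hCR0.le
          linarith [hL₃R]
  -- (iii) the horizontal integrals
  have hH : ∀ H : ℂ, ‖H‖ ≤ x ^ b * (Λ₁ + 6 + 3 / 2 * Real.log (1 + 1 / Real.log x)) / Real.log x →
      ‖H‖ ≤ (27 * A₀ + 77) * W := by
    intro H hH
    refine hH.trans ?_
    rw [← hL, ← hlg]
    have hℓ9 : ℓ ^ 2 ≤ 9 * Real.log T ^ 2 := by
      calc ℓ ^ 2 ≤ (3 * Real.log T) ^ 2 := pow_le_pow_left₀ hℓ0 hℓ3 2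
        _ = 9 * Real.log T ^ 2 := by ring
    have hq1 : 0 ≤ Ch * ℓ * (2 + ℓ / c₀) :=
      mul_nonneg (mul_nonneg hCh0.le hℓ0) (add_nonneg zero_le_two (div_nonneg hℓ0 hc₀0.le))
    have hΛ₁0 : 0 ≤ Λ₁ := by rw [hΛ₁def]; linarith [hCr0.le, hM₀0, hℓ0]
    have hnum0 : 0 ≤ Λ₁ + 6 + 3 / 2 * lg := by linarith
    calc x ^ b * (Λ₁ + 6 + 3 / 2 * lg) / L ≤ 3 * x * (A₀ * (9 * Real.log T ^ 2) + 6 + 3 / 2 * lg) / L := by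
          gcongr
          exact hΛ₁A.trans (by gcongr)
      _ = 27 * A₀ * (x * Real.log T ^ 2 / L) + 18 * (x / L) + 9 / 2 * (x * lg / L) := by
          ring
      _ ≤ (27 * A₀ + 77) * W := by
          have u1 : 27 * A₀ * (x * Real.log T ^ 2 / L) ≤ 27 * A₀ * W :=
            mul_le_mul_of_nonneg_left hW2 (by positivity)
          linarith [u1, hxLW, hW3, hW0]
  have h_iii : ‖I * (Hb - Ht) / (2 * π)‖ ≤ 2 * (27 * A₀ + 77) * W := by
    rw [norm_div, norm_mul, Complex.norm_I, one_mul, hnorm2π]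
    have h2π : (1 : ℝ) ≤ 2 * π := by linarith [Real.pi_gt_three]
    have hb' := hH Hb hHbot
    have ht' := hH Ht hHtop
    calc ‖Hb - Ht‖ / (2 * π) ≤ ‖Hb - Ht‖ := div_le_self (norm_nonneg _) h2π
      _ ≤ ‖Hb‖ + ‖Ht‖ := norm_sub_le _ _
      _ ≤ (27 * A₀ + 77) * W + (27 * A₀ + 77) * W := add_le_add hb' ht'
      _ = 2 * (27 * A₀ + 77) * W := by ring
  -- (iv) the zeros between `T` and `T₁`
  have h_iv : ‖S - S₁‖ ≤ 24 * Cw * W := by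
    rw [norm_sub_rev]
    refine hS.trans ?_
    have hlog52 : Real.log (T + 5 / 2) ≤ 3 * Real.log T := by
      have h4 : Real.log (T + 5 / 2) ≤ Real.log (4 * T) := Real.log_le_log (by linarith) (by linarith)
      rw [Real.log_mul (by norm_num) hT0.ne', show (4 : ℝ) = 2 * 2 by norm_num,
        Real.log_mul two_ne_zero two_ne_zero] at h4
      linarith
    have hlsq : Real.log T ≤ 2 * Real.log T ^ 2 :=
      calc Real.log T = Real.log T * 1 := by ring
        _ ≤ Real.log T * (2 * Real.log T) := mul_le_mul_of_nonneg_left (by linarith) (by linarith)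
        _ = 2 * Real.log T ^ 2 := by ring
    have hxpos : 0 ≤ x := hx0.le
    calc x * D ≤ x * (4 * Cw * Real.log (T + 5 / 2)) := mul_le_mul_of_nonneg_left hD hxpos
      _ ≤ x * (4 * Cw * (3 * (2 * Real.log T ^ 2))) := by
          refine mul_le_mul_of_nonneg_left ?_ hxpos
          exact mul_le_mul_of_nonneg_left (hlog52.trans (by linarith)) (by positivity)
      _ = 24 * Cw * (x * Real.log T ^ 2) := by ring
      _ ≤ 24 * Cw * W := mul_le_mul_of_nonneg_left hW1 (by positivity)
  -- (v) the main term between `T` and `T₁`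
  have h_v : ‖((((T₁ - T) / π * Λr : ℝ)) : ℂ)‖ ≤ 4 * W := by
    rw [Complex.norm_real, Real.norm_eq_abs, abs_of_nonneg (by positivity)]
    have h1 : (T₁ - T) / π ≤ 1 := by
      rw [div_le_one hπ0]; linarith [Real.pi_gt_three]
    calc (T₁ - T) / π * Λr ≤ 1 * Λr := mul_le_mul_of_nonneg_right h1 hΛr0
      _ ≤ x := by rw [one_mul]; exact hΛrle
      _ ≤ 4 * W := hxW
  -- conclusion
  rw [htarget]
  have hCQ : 24 * Cw * W + 6 * W + CR * (2 * R + P) + 2 * (27 * A₀ + 77) * W + 4 * W ≤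
      (164 + 2 * CR + 54 * A₀ + 24 * Cw) * (W + R + P) := by
    have e : (164 + 2 * CR + 54 * A₀ + 24 * Cw) * (W + R + P) -
        (24 * Cw * W + 6 * W + CR * (2 * R + P) + 2 * (27 * A₀ + 77) * W + 4 * W) =
        2 * CR * W + (164 + 54 * A₀ + 24 * Cw) * R + (164 + CR + 54 * A₀ + 24 * Cw) * P := by ring
    have p1 : 0 ≤ 2 * CR * W := by positivity
    have p2 : 0 ≤ (164 + 54 * A₀ + 24 * Cw) * R := by positivity
    have p3 : 0 ≤ (164 + CR + 54 * A₀ + 24 * Cw) * P := by positivity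
    linarith
  have hfinal : (164 + 2 * CR + 54 * A₀ + 24 * Cw) * (W + R + P) =
      (164 + 2 * CR + 54 * A₀ + 24 * Cw) *
        (x * (Real.log T ^ 2 + Real.log (1 + 1 / Real.log x)) * (1 + 1 / Real.log x) +
          x * Real.log (3 * x) ^ 2 + Real.log (3 * x) * min T (x / primePowDist x)) := by
    rw [hW, hRdef, hP, hlg, hL, hL₃]
  calc ‖S - S₁ + ((x : ℂ) - cx) - (V - (((2 * T₁ * Λr : ℝ)) : ℂ)) / (2 * π) +
          I * (Hb - Ht) / (2 * π) - ((((T₁ - T) / π * Λr : ℝ)) : ℂ)‖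
      ≤ ‖S - S₁‖ + ‖(x : ℂ) - cx‖ + ‖(V - (((2 * T₁ * Λr : ℝ)) : ℂ)) / (2 * π)‖ +
          ‖I * (Hb - Ht) / (2 * π)‖ + ‖((((T₁ - T) / π * Λr : ℝ)) : ℂ)‖ := by
        refine (norm_sub_le _ _).trans ?_
        refine add_le_add ((norm_add_le _ _).trans (add_le_add ((norm_sub_le _ _).trans
          (add_le_add (norm_add_le _ _) le_rfl)) le_rfl)) le_rfl
    _ ≤ 24 * Cw * W + 6 * W + CR * (2 * R + P) + 2 * (27 * A₀ + 77) * W + 4 * W := by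
        gcongr
    _ ≤ (164 + 2 * CR + 54 * A₀ + 24 * Cw) * (W + R + P) := hCQ
    _ = _ := hfinal

end LandauGonek

end Literature.NumberTheory.LFunctions

end
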